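import Summits.AnomalousDissipation.AnomalousDissipation.Theorems.SawtoothPulseCascadeK1LocalisedCascadeTraceInput

/-!
# K1loc, line `Spectral` / thin start — helper: TRAPEZOID MULTIPLIERS WITH SMALL KERNEL `L¹` NORM («TraceKernels»)

Helper file of the prover lane on the crux `K1LocalisedCascade` (stmt-AnomalousDissipation-19491), route `SawtoothPulseCascade`
(glue seat; arbiter A23-11 (iv) / A23-12 (i): the CT plumbing).  `…TraceInput.sum_sq_trace_le_{h,v}fibre` needs a multiplier `χ` on
the sources with `χ = 1` on the plateau `|l| ≤ L` (so that the off-plateau sources are split off by unitarity), `0 ≤ χ ≤ 1`, finite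
support, and a bound `∫_𝕋 |Σ_l χ_l e^{2πily} e_{−l}(t)| dt ≤ K₁`.  This file supplies the BOX-PRODUCT TRAPEZOIDS: for `L R ≥ 1`,
  `χ_l := N(l)/R`, `N(l) = #{(j,j′) ∈ [−L, L+R) × [0, R) : j − j′ = l}`
(`= 1` for `|l| ≤ L`, `∈ [0,1]`, `= 0` for `|l| ≥ L + R`), whose kernel is `(1/R)·D_I(s)·conj D_J(s)` (`D_I = Σ_{j∈I} e^{2πijs}`), so
by `2|D_I||D_J| ≤ ε|D_I|² + |D_J|²/ε` and the finite Parseval identity **`K₁ = √((2L+R)/R)`** (`R = 2L`: `√2`; `R = 4L`: `√(3/2)`) —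
better than the Fejér-difference trapezoids (`(m+1)/(m−1)`) and with no positivity argument.  Main statements:
`trapezoid_card_eq_of_plateau`, `trapezoid_card_le`, `trapezoid_card_eq_zero`, `trapezoid_kernel_eq` (the product structure),
`integral_norm_trapezoid_kernel_le` (the `L¹` bound, every `y`), and the plug-ins `sum_sq_trace_trapezoid_le_{h,v}fibre`
(`…TraceInput` with this `χ`: trace `≤ (√(AB)/B·‖b‖_∞)²`).  Also `integral_norm_sq_trigSum_eq` (one-variable finite Parseval).
No definitions; nothing about the crux. [cite: Grafakos2014, Prop. 3.1.2 (5), Prop. 3.2.7 (3), §3.1.3] [problem: turb]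
-/

-- `Summit.<Summit>.<Problem>`: single-conjunct summit, the duplicate namespace segment is deliberate.
set_option linter.dupNamespace false

noncomputable section

namespace Summit.AnomalousDissipation.AnomalousDissipation.Theorems.SawtoothPulseCascade.K1Window

open MeasureTheory Complex UnitAddTorus
open scoped Real
open Literature.Analysis.FunctionSpaces Literature.Analysis.FunctionSpaces.Torus

/-! ## §1 One-variable finite Parseval -/

/-- **Finite Parseval on `𝕋`**: `∫_𝕋 |Σ_{n∈F} d_n e_{−n}|² = Σ_{n∈F} |d_n|²`. [cite: Grafakos2014, Prop. 3.2.7 (3)] -/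
theorem integral_norm_sq_trigSum_eq (F : Finset ℤ) (dcoef : ℤ → ℂ) :
    ∫ t : UnitAddCircle, ‖∑ n ∈ F, dcoef n * fourier (-n) t‖ ^ 2 = ∑ n ∈ F, ‖dcoef n‖ ^ 2 := by
  classical
  set ι : ℤ → (Fin 2 → ℤ) := fun n => ![-n, 0] with hι
  have hιinj : Function.Injective ι := by
    intro a b h
    have := congr_fun h 0
    simpa [hι] using this
  set c : (Fin 2 → ℤ) → ℂ := fun k => dcoef (-(k 0)) with hc
  have hD : ∀ x : UnitAddTorus (Fin 2), trigPoly (F.image ι) c x = ∑ n ∈ F, dcoef n * fourier (-n) (x 0) := by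
    intro x
    rw [trigPoly_apply, Finset.sum_image fun a _ b _ h => hιinj h]
    refine Finset.sum_congr rfl fun n _ => ?_
    rw [hι, hc, smul_eq_mul, mFourier_vecCons_zero]
    simp [mul_comm]
  have hP : ∫ x : UnitAddTorus (Fin 2), ‖trigPoly (F.image ι) c x‖ ^ 2 = ∑ n ∈ F, ‖dcoef n‖ ^ 2 := by
    rw [integral_norm_sq_trigPoly, Finset.sum_image fun a _ b _ h => hιinj h]
    refine Finset.sum_congr rfl fun n _ => ?_
    simp [hι, hc]
  rw [← hP]
  simp_rw [hD]
  exact (integral_coord_zero_eq (fun t => ‖∑ n ∈ F, dcoef n * fourier (-n) t‖ ^ 2)).symm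

/-! ## §2 The pair counts of the box product -/

/-- **Plateau**: for `a ≤ l` and `l + B ≤ a + A` every `j′ ∈ [0,B)` has its partner `j = l + j′ ∈ [a, a+A)`, so the count is `B`.
[folklore] -/
theorem trapezoid_card_eq_of_plateau (a : ℤ) (A B : ℕ) {l : ℤ} (h1 : a ≤ l) (h2 : l + B ≤ a + A) :
    (((Finset.Ico a (a + A)) ×ˢ (Finset.Ico (0 : ℤ) B)).filter (fun p : ℤ × ℤ => p.1 - p.2 = l)).card = B := by
  have hset : ((Finset.Ico a (a + A)) ×ˢ (Finset.Ico (0 : ℤ) B)).filter (fun p : ℤ × ℤ => p.1 - p.2 = l) =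
      (Finset.Ico (0 : ℤ) B).image (fun j' => (l + j', j')) := by
    ext ⟨j, j'⟩
    simp only [Finset.mem_filter, Finset.mem_product, Finset.mem_Ico, Finset.mem_image, Prod.mk.injEq]
    constructor
    · rintro ⟨⟨⟨hj1, hj2⟩, hj'1, hj'2⟩, hl⟩
      exact ⟨j', ⟨hj'1, hj'2⟩, by omega, rfl⟩
    · rintro ⟨k, ⟨hk1, hk2⟩, hk3, rfl⟩
      refine ⟨⟨⟨by omega, by omega⟩, hk1, hk2⟩, by omega⟩
  rw [hset, Finset.card_image_of_injective _ (fun x y h => by simpa using congrArg Prod.snd h)]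
  simp

/-- **Height**: the count never exceeds `B` (the second coordinate determines the pair). [folklore] -/
theorem trapezoid_card_le (a : ℤ) (A B : ℕ) (l : ℤ) :
    (((Finset.Ico a (a + A)) ×ˢ (Finset.Ico (0 : ℤ) B)).filter (fun p : ℤ × ℤ => p.1 - p.2 = l)).card ≤ B := by
  have h : (((Finset.Ico a (a + A)) ×ˢ (Finset.Ico (0 : ℤ) B)).filter (fun p : ℤ × ℤ => p.1 - p.2 = l)).card ≤
      (Finset.Ico (0 : ℤ) B).card := by
    refine Finset.card_le_card_of_injOn Prod.snd (fun p hp => ?_) (fun p hp q hq h => ?_)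
    · simp only [Finset.coe_filter, Finset.mem_product, Set.mem_setOf_eq] at hp
      exact hp.1.2
    · simp only [Finset.coe_filter, Finset.mem_product, Set.mem_setOf_eq] at hp hq
      have h1 : p.1 = q.1 := by have := hp.2; have := hq.2; omega
      exact Prod.ext h1 h
  simpa using h

/-- **Support**: the count vanishes for `l ≤ a − B` or `a + A ≤ l`. [folklore] -/
theorem trapezoid_card_eq_zero (a : ℤ) (A B : ℕ) {l : ℤ} (h : l + B ≤ a ∨ a + A ≤ l) :
    (((Finset.Ico a (a + A)) ×ˢ (Finset.Ico (0 : ℤ) B)).filter (fun p : ℤ × ℤ => p.1 - p.2 = l)).card = 0 := by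
  rw [Finset.card_eq_zero, Finset.filter_eq_empty_iff]
  rintro ⟨j, j'⟩ hp
  simp only [Finset.mem_product, Finset.mem_Ico] at hp
  dsimp only
  omega

/-! ## §3 The kernel of the box-product trapezoid is a product of two exponential sums -/

/-- The elementary characters `u_j(y,t) = e^{2πijy} e_{−j}(t)` are multiplicative: `u_j · conj u_{j′} = u_{j−j′}`. [folklore] -/
theorem expChar_mul_conj (j j' : ℤ) (y : ℝ) (t : UnitAddCircle) :
    (cexp (2 * π * I * j * y) * fourier (-j) t) * (starRingEnd ℂ) (cexp (2 * π * I * j' * y) * fourier (-j') t) =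
      cexp (2 * π * I * ((j - j' : ℤ) : ℂ) * y) * fourier (-(j - j')) t := by
  have h1 : (starRingEnd ℂ) (cexp (2 * π * I * j' * y)) = cexp (2 * π * I * ((-j' : ℤ) : ℂ) * y) := by
    rw [← Complex.exp_conj]
    congr 1
    simp only [map_mul, map_ofNat, Complex.conj_ofReal, Complex.conj_I, map_intCast, Int.cast_neg]
    ring
  have h2 : (starRingEnd ℂ) (fourier (-j') t : ℂ) = fourier j' t := by
    rw [← fourier_neg, neg_neg]
  rw [map_mul, h1, h2]
  have h3 : (fourier (-(j - j')) t : ℂ) = fourier (-j) t * fourier j' t := by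
    rw [show -(j - j') = -j + j' by ring, fourier_add]
  rw [h3]
  have h4 : cexp (2 * π * I * ((j - j' : ℤ) : ℂ) * y) = cexp (2 * π * I * j * y) * cexp (2 * π * I * ((-j' : ℤ) : ℂ) * y) := by
    rw [← Complex.exp_add]; congr 1; push_cast; ring
  rw [h4]; ring

/-- **Product structure of the trapezoid kernel**: with `N(l)` the pair count of `[a, a+A) × [0, B)`,
`Σ_{l ∈ (a−B, a+A)} N(l)·u_l = (Σ_{j∈[a,a+A)} u_j)·conj(Σ_{j′∈[0,B)} u_{j′})`. [folklore] -/
theorem trapezoid_kernel_eq (a : ℤ) (A B : ℕ) (y : ℝ) (t : UnitAddCircle) :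
    ∑ l ∈ Finset.Ioo (a - B) (a + A),
        ((((Finset.Ico a (a + A)) ×ˢ (Finset.Ico (0 : ℤ) B)).filter (fun p : ℤ × ℤ => p.1 - p.2 = l)).card : ℂ) *
          (cexp (2 * π * I * l * y) * fourier (-l) t) =
      (∑ j ∈ Finset.Ico a (a + A), cexp (2 * π * I * j * y) * fourier (-j) t) *
        (starRingEnd ℂ) (∑ j' ∈ Finset.Ico (0 : ℤ) B, cexp (2 * π * I * j' * y) * fourier (-j') t) := by
  classical
  rw [map_sum, Finset.sum_mul_sum, ← Finset.sum_product']
  -- group the pairs by the value of `j − j′`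
  have hmaps : ∀ p ∈ (Finset.Ico a (a + A)) ×ˢ (Finset.Ico (0 : ℤ) B), p.1 - p.2 ∈ Finset.Ioo (a - B) (a + A) := by
    rintro ⟨j, j'⟩ hp
    simp only [Finset.mem_product, Finset.mem_Ico] at hp
    simp only [Finset.mem_Ioo]
    omega
  rw [← Finset.sum_fiberwise_of_maps_to hmaps]
  refine Finset.sum_congr rfl fun l _ => ?_
  rw [Finset.sum_filter]
  have hterm : ∀ p ∈ (Finset.Ico a (a + A)) ×ˢ (Finset.Ico (0 : ℤ) B),
      (if p.1 - p.2 = l then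
        (cexp (2 * π * I * p.1 * y) * fourier (-p.1) t) * (starRingEnd ℂ) (cexp (2 * π * I * p.2 * y) * fourier (-p.2) t)
        else 0) =
      if p.1 - p.2 = l then cexp (2 * π * I * l * y) * fourier (-l) t else 0 := by
    rintro ⟨j, j'⟩ _
    split_ifs with h
    · rw [expChar_mul_conj, ← h]
    · rfl
  rw [Finset.sum_congr rfl hterm, ← Finset.sum_filter, Finset.sum_const, nsmul_eq_mul]

/-! ## §4 The `L¹` bound -/

/-- **`L¹` NORM OF THE TRAPEZOID KERNEL**: for `A, B ≥ 1`, every `a ∈ ℤ` and every `y ∈ ℝ`,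
`∫_𝕋 |Σ_l (N(l)/B) e^{2πily} e_{−l}(t)| dt ≤ √(A·B)/B` (`= √(A/B)`; for the symmetric trapezoid `a = −L`, `A = 2L+R`, `B = R`:
`√((2L+R)/R)`).  Pointwise `|D_I||D_J| ≤ (ε|D_I|² + |D_J|²/ε)/2` with `ε = √(B/A)` and `∫|D_I|² = A`, `∫|D_J|² = B`.
[cite: Grafakos2014, Prop. 3.2.7 (3)] -/
theorem integral_norm_trapezoid_kernel_le (a : ℤ) {A B : ℕ} (hA : 0 < A) (hB : 0 < B) (y : ℝ) :
    ∫ t : UnitAddCircle, ‖∑ l ∈ Finset.Ioo (a - B) (a + A),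
        (((((Finset.Ico a (a + A)) ×ˢ (Finset.Ico (0 : ℤ) B)).filter (fun p : ℤ × ℤ => p.1 - p.2 = l)).card : ℂ) / B) *
          cexp (2 * π * I * l * y) * fourier (-l) t‖ ≤ Real.sqrt (A * B) / B := by
  classical
  have hAr : (0 : ℝ) < A := by exact_mod_cast hA
  have hBr : (0 : ℝ) < B := by exact_mod_cast hB
  set DI : UnitAddCircle → ℂ := fun t => ∑ j ∈ Finset.Ico a (a + A), cexp (2 * π * I * j * y) * fourier (-j) t with hDI
  set DJ : UnitAddCircle → ℂ := fun t => ∑ j' ∈ Finset.Ico (0 : ℤ) B, cexp (2 * π * I * j' * y) * fourier (-j') t with hDJ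
  have hDIc : Continuous DI := by
    refine continuous_finsetSum _ fun n _ => continuous_const.mul (fourier (-n)).continuous
  have hDJc : Continuous DJ := by
    refine continuous_finsetSum _ fun n _ => continuous_const.mul (fourier (-n)).continuous
  -- the integrand equals `(1/B)·|DI|·|DJ|`
  have hpt : ∀ t : UnitAddCircle, ‖∑ l ∈ Finset.Ioo (a - B) (a + A),
      (((((Finset.Ico a (a + A)) ×ˢ (Finset.Ico (0 : ℤ) B)).filter (fun p : ℤ × ℤ => p.1 - p.2 = l)).card : ℂ) / B) *
        cexp (2 * π * I * l * y) * fourier (-l) t‖ = (1 / B) * (‖DI t‖ * ‖DJ t‖) := by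
    intro t
    have e1 : ∑ l ∈ Finset.Ioo (a - B) (a + A),
        (((((Finset.Ico a (a + A)) ×ˢ (Finset.Ico (0 : ℤ) B)).filter (fun p : ℤ × ℤ => p.1 - p.2 = l)).card : ℂ) / B) *
          cexp (2 * π * I * l * y) * fourier (-l) t =
        (1 / (B : ℂ)) * ∑ l ∈ Finset.Ioo (a - B) (a + A),
          ((((Finset.Ico a (a + A)) ×ˢ (Finset.Ico (0 : ℤ) B)).filter (fun p : ℤ × ℤ => p.1 - p.2 = l)).card : ℂ) *
            (cexp (2 * π * I * l * y) * fourier (-l) t) := by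
      rw [Finset.mul_sum]
      refine Finset.sum_congr rfl fun l _ => ?_
      ring
    rw [e1, trapezoid_kernel_eq, norm_mul, norm_mul, RCLike.norm_conj, norm_div, norm_one, Complex.norm_natCast]
  simp_rw [hpt]
  rw [integral_const_mul]
  -- one-variable energies
  have hEI : ∫ t : UnitAddCircle, ‖DI t‖ ^ 2 = A := by
    have h := integral_norm_sq_trigSum_eq (Finset.Ico a (a + A)) (fun j => cexp (2 * π * I * j * y))
    have e : ∑ n ∈ Finset.Ico a (a + A), ‖cexp (2 * π * I * n * y)‖ ^ 2 = A := by
      have e1 : ∀ n : ℤ, ‖cexp (2 * π * I * n * y)‖ ^ 2 = 1 := fun n => by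
        rw [show (2 * π * I * n * y : ℂ) = ((2 * π * n * y : ℝ) : ℂ) * I by push_cast; ring, Complex.norm_exp_ofReal_mul_I]
        norm_num
      simp_rw [e1]
      simp
    rw [e] at h
    exact h
  have hEJ : ∫ t : UnitAddCircle, ‖DJ t‖ ^ 2 = B := by
    have h := integral_norm_sq_trigSum_eq (Finset.Ico (0 : ℤ) B) (fun j => cexp (2 * π * I * j * y))
    have e : ∑ n ∈ Finset.Ico (0 : ℤ) B, ‖cexp (2 * π * I * n * y)‖ ^ 2 = B := by
      have e1 : ∀ n : ℤ, ‖cexp (2 * π * I * n * y)‖ ^ 2 = 1 := fun n => by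
        rw [show (2 * π * I * n * y : ℂ) = ((2 * π * n * y : ℝ) : ℂ) * I by push_cast; ring, Complex.norm_exp_ofReal_mul_I]
        norm_num
      simp_rw [e1]
      simp
    rw [e] at h
    exact h
  -- AM–GM with `ε = √(B/A)`
  set ε : ℝ := Real.sqrt (B / A) with hε
  have hεpos : 0 < ε := Real.sqrt_pos.2 (div_pos hBr hAr)
  have hamgm : ∀ t : UnitAddCircle, ‖DI t‖ * ‖DJ t‖ ≤ (ε / 2) * ‖DI t‖ ^ 2 + (1 / (2 * ε)) * ‖DJ t‖ ^ 2 := by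
    intro t
    have h0 : 0 ≤ (ε * ‖DI t‖ - ‖DJ t‖) ^ 2 := sq_nonneg _
    have e0 : (ε * ‖DI t‖ - ‖DJ t‖) ^ 2 = ε ^ 2 * ‖DI t‖ ^ 2 + ‖DJ t‖ ^ 2 - 2 * ε * (‖DI t‖ * ‖DJ t‖) := by ring
    rw [e0] at h0
    rw [show (ε / 2) * ‖DI t‖ ^ 2 + (1 / (2 * ε)) * ‖DJ t‖ ^ 2 = (ε ^ 2 * ‖DI t‖ ^ 2 + ‖DJ t‖ ^ 2) / (2 * ε) by
      field_simp]
    rw [le_div_iff₀ (by positivity)]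
    linarith
  have hI1 : Integrable (fun t => ‖DI t‖ * ‖DJ t‖) volume :=
    (hDIc.norm.mul hDJc.norm).integrable_of_hasCompactSupport (HasCompactSupport.of_compactSpace _)
  have hI2 : Integrable (fun t => (ε / 2) * ‖DI t‖ ^ 2 + (1 / (2 * ε)) * ‖DJ t‖ ^ 2) volume :=
    (((hDIc.norm.pow 2).const_mul _).add ((hDJc.norm.pow 2).const_mul _)).integrable_of_hasCompactSupport
      (HasCompactSupport.of_compactSpace _)
  have hJ1 : Integrable (fun t : UnitAddCircle => (ε / 2) * ‖DI t‖ ^ 2) volume :=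
    ((hDIc.norm.pow 2).const_mul _).integrable_of_hasCompactSupport (HasCompactSupport.of_compactSpace _)
  have hJ2 : Integrable (fun t : UnitAddCircle => (1 / (2 * ε)) * ‖DJ t‖ ^ 2) volume :=
    ((hDJc.norm.pow 2).const_mul _).integrable_of_hasCompactSupport (HasCompactSupport.of_compactSpace _)
  have hle : ∫ t : UnitAddCircle, ‖DI t‖ * ‖DJ t‖ ≤ Real.sqrt (A * B) := by
    refine (integral_mono hI1 hI2 hamgm).trans ?_
    rw [integral_add hJ1 hJ2, integral_const_mul, integral_const_mul, hEI, hEJ]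
    -- `(ε/2)A + B/(2ε) = √(AB)` for `ε = √(B/A)`
    have hεsq : ε ^ 2 = B / A := Real.sq_sqrt (div_pos hBr hAr).le
    have hsAB : Real.sqrt (A * B) = ε * A := by
      have e1 : ε * A = Real.sqrt (B / A * A ^ 2) := by
        rw [Real.sqrt_mul (div_pos hBr hAr).le, Real.sqrt_sq hAr.le]
      rw [e1]
      congr 1
      field_simp
    rw [hsAB]
    have hB' : (B : ℝ) = ε ^ 2 * A := by rw [hεsq]; field_simp
    have : 1 / (2 * ε) * (B : ℝ) = ε * A / 2 := by
      rw [hB']; field_simp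
    rw [this]
    linarith
  calc 1 / (B : ℝ) * ∫ t : UnitAddCircle, ‖DI t‖ * ‖DJ t‖ ≤ 1 / (B : ℝ) * Real.sqrt (A * B) :=
        mul_le_mul_of_nonneg_left hle (by positivity)
    _ = Real.sqrt (A * B) / B := by ring

/-- **The symmetric trapezoid** (plateau `[−L, L]`, ramps of length `R`): the multiplier
`χ_l = N(l)/R` of the box product `[−L, L+R) × [0, R)` has `L¹` kernel norm at most `√((2L+R)·R)/R = √((2L+R)/R)` for every `y`.
[cite: Grafakos2014, Prop. 3.2.7 (3)] -/
theorem integral_norm_symmTrapezoid_kernel_le {L R : ℕ} (hR : 0 < R) (y : ℝ) :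
    ∫ t : UnitAddCircle, ‖∑ l ∈ Finset.Ioo (-(L : ℤ) - R) (-(L : ℤ) + (2 * L + R : ℕ)),
        (((((Finset.Ico (-(L : ℤ)) (-(L : ℤ) + (2 * L + R : ℕ))) ×ˢ (Finset.Ico (0 : ℤ) R)).filter
            (fun p : ℤ × ℤ => p.1 - p.2 = l)).card : ℂ) / R) *
          cexp (2 * π * I * l * y) * fourier (-l) t‖ ≤ Real.sqrt ((2 * L + R : ℕ) * R) / R :=
  integral_norm_trapezoid_kernel_le (-(L : ℤ)) (by omega) hR y

/-! ## §5 Plugged into the input-free trace bound -/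

/-- **Input-free trace bound with the box-product trapezoid, H orientation**: for `b` integrable with `‖b x‖ ≤ Bsup`,
`Σ_{n∈F} |Σ_l (N(l)/B) 𝓕b(n,l) e^{2πily}|² ≤ (√(AB)/B · Bsup)²`. [cite: Grafakos2014, Prop. 3.1.2 (5), Prop. 3.2.7 (3)] -/
theorem sum_sq_trace_trapezoid_le_hfibre {b : UnitAddTorus (Fin 2) → ℂ} (hb : Integrable b volume) {Bsup : ℝ}
    (hBsup : ∀ x, ‖b x‖ ≤ Bsup) (a : ℤ) {A B : ℕ} (hA : 0 < A) (hB : 0 < B) (F : Finset ℤ) (y : ℝ) :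
    ∑ n ∈ F, ‖∑ l ∈ Finset.Ioo (a - B) (a + A),
        (((((Finset.Ico a (a + A)) ×ˢ (Finset.Ico (0 : ℤ) B)).filter (fun p : ℤ × ℤ => p.1 - p.2 = l)).card : ℂ) / B) *
          mFourierCoeff b ![n, l] * cexp (2 * π * I * l * y)‖ ^ 2 ≤ (Real.sqrt (A * B) / B * Bsup) ^ 2 :=
  sum_sq_trace_le_hfibre hb hBsup _ _ F y (integral_norm_trapezoid_kernel_le a hA hB y)

/-- **Input-free trace bound with the box-product trapezoid, V orientation.** [cite: Grafakos2014, Prop. 3.1.2 (5), Prop. 3.2.7 (3)] -/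
theorem sum_sq_trace_trapezoid_le_vfibre {b : UnitAddTorus (Fin 2) → ℂ} (hb : Integrable b volume) {Bsup : ℝ}
    (hBsup : ∀ x, ‖b x‖ ≤ Bsup) (a : ℤ) {A B : ℕ} (hA : 0 < A) (hB : 0 < B) (F : Finset ℤ) (y : ℝ) :
    ∑ n ∈ F, ‖∑ l ∈ Finset.Ioo (a - B) (a + A),
        (((((Finset.Ico a (a + A)) ×ˢ (Finset.Ico (0 : ℤ) B)).filter (fun p : ℤ × ℤ => p.1 - p.2 = l)).card : ℂ) / B) *
          mFourierCoeff b ![l, n] * cexp (2 * π * I * l * y)‖ ^ 2 ≤ (Real.sqrt (A * B) / B * Bsup) ^ 2 :=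
  sum_sq_trace_le_vfibre hb hBsup _ _ F y (integral_norm_trapezoid_kernel_le a hA hB y)

end Summit.AnomalousDissipation.AnomalousDissipation.Theorems.SawtoothPulseCascade.K1Window
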